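import Literature.MathematicalPhysics.QuantumFieldTheory.Balaban1983to89.Beta.GradedBubbles
import Literature.MathematicalPhysics.QuantumFieldTheory.Balaban1983to89.Beta.GhostTable

/-!
# `BalabanUV.Beta.D1BFx.ScaleLegRows` — road «BF-x» for binder row D1, «A3.c ∕ L-X TAILS» part (B): the TWO-REGIME leg calculus of a
# scale-`n` profile `g` from its four displayed rows d0∕d1 (far, `e^{−(δ/n)‖v‖∞}/‖v‖∞^{2,3}`) and h0∕h1 (flat part `g − gFree`:
# `D₀/n²`, `D₁/n³`) — soft all-`v` forms, iterated unit differences, translates, and the fixed-`n` exponential envelope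

HONEST DEPENDENCY (page 1, mandatory): continuum YM on T⁴ ⇐ BetaPertH ∧ nine spine estimates (0/9 proved); BetaPertH ⇐ (D1) ∧ (D4) ∧
CAP+tail; G-an2-4 gates asym, D1 and NE2/3/4.  HONEST FRAMING (cell contract, verbatim): «discharging `BetaPertH` makes Bałaban's UV
stability UNCONDITIONAL — a real constructive-QFT result; it is NOT the continuum limit and NOT the Clay problem.»  THIS MODULE DISCHARGES
NOTHING of the wall: [folklore] real inequalities on `ℤ⁴` about an ARBITRARY function `g : ℤ⁴ → ℝ` under four hypotheses written in the
LITERAL shape of the road END's rows for the frozen profile `gfrz n a b` (`FrozenLegTails.far_rows_d0_d1_of_prop12` — theorems modulo the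
PRINTED `h12`∕`h126`; `FrozenLegProfile.abs_gfrz_sub_gFree_le`∕`abs_gfrz_diff_flat_le` — unconditional).  Nothing about Bałaban's kernels
is asserted here; no `def`, no `Prop` minted, nothing cited, 0 sorry.  0 wall binders; NOT the L-X row, NOT A3.c, NOT (K), NOT D1, NOT
`BetaPertH`, NOT continuum, NOT Clay.

ABSOLUTE RULE (cell charter, verbatim): «No internally-minted statement may enter as a cited fact. Every hypothesis is either kernel-proved in
this package or a verbatim quotation of a PUBLISHED theorem with page reference. The manuscript(s) under audit are NOT citable for their own
disputed steps — they are the thing under adjudication; programme-internal (2001/route/tribunal) claims are never citable.»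

WHY (owner d1-p2-g9 RULING ρ-g9-31 «(β): L-X re-cut to the END's currency, NO d3 letter»; this lineage's N-d1leaf03g12-1, journal l.29701).
The elementary terms of part (A) carry legs `iterD as (fun _ _ ↦ g) 0 0` — iterated unit differences of the profile.  Part (C)'s counting needs
for each such leg, UNIFORMLY IN `n`: (far) `|∂^{as}g (u)| ≤ B·e^{−(δ/n)‖u‖∞}/(‖u‖∞+1)^{2+min(|as|,1)}`; (window, flat part
`φ = g − gFree`) `|∂^{as}φ (u)| ≤ D₀/n²` (`as = []`), `≤ 2^{|as|−1}D₁/n³` (`as ≠ []`); (fixed `n`) an exponential `ℓ¹` envelope for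
summability.  All three are crude consequences (differences beyond the first taken term by term, translates by unit steps) of the four rows.
* §0 [folklore] `abs_coord_le_supNorm`, unit-step norm facts, exponential ∕ denominator transport.
* §1 [folklore] SOFT ROWS: `soft_d0` (`|g v| ≤ (4A₀ + |gFree 0| + D₀)·E(v)/(‖v‖∞+1)²` for ALL `v`), `soft_d1`.
* §2 [folklore] PROPAGATION through `iterD` on constant families: `abs_iterD_const_le_of_sup` (sup bounds double), `abs_fdiffF_const_le_soft`,
  `abs_iterD_const_le_soft` (soft-exponential bounds keep their shape, constant `(1 + 2^p e^δ)` per step).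
* §3 [folklore] THE LEGS: **`abs_iterD_flat_nil_le`∕`abs_iterD_flat_cons_le`** (flat part), **`abs_iterD_far_nil_le`∕`abs_iterD_far_cons_le`** (far),
  **`exists_envelope_iterD`** (fixed-`n` `ℓ¹` envelope).
ROWS A FLAT LEG SUPPLIES (owner ρ-g9-32 (i), for PART II = the 8 A3.c words whose legs `legPiece 1 = diagPart Ga − frozenLeg gfrz`,
`legPiece 2 = offPart Ga` have NO free part): the window grades `D₀/n²` (entry), `D₁/n³` (one difference at EITHER end),
`D₂/n⁴` (one difference at EACH end) of `DiagonalLegGrade.abs_Kinf_diag_sub_G₀_le`∕`_flat_sub_left∕right∕sub_le` and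
`OffDiagonalLegGrade.abs_Kinf_offDiag_le_four`∕`_sub_base∕disp∕sub_le_four`; two differences at the SAME end are taken crudely (`2·D₁/n³`,
§2 `abs_iterD_const_le_of_sup`), exactly as h1 is used here — the counting of part (C) needs `min(#differences, 1)` per leg only.
Unit `b2b-balaban-beta-d1-formalise-leaf-03` (gen 12), D1 formalisation swarm; `LEAVES-BFx.md` row «A3.c ∕ L-X TAILS» part (B).
-/

noncomputable section

namespace Summit.QuantumFields.BalabanUV.Beta.D1BFx.ScaleLegRows

open Literature.MathematicalPhysics.QuantumFieldTheory.Balaban1983to89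
open Literature.MathematicalPhysics.QuantumFieldTheory.Balaban1983to89.Beta
open B12Sec2to5 (l1 l1_nonneg abs_coord_le_l1)
open DyadicShell (Pt supNorm toReal toReal_apply norm_toReal supNorm_eq_zero_iff)
open BubbleTransfer (unitVec)
open GhostTable (gFree)
open TwoPowerLegs (supNorm_unitVec supNorm_neg_unitVec supNorm_sub_le_supNorm_add)
open BlockLegs (supNorm_add_le_real)
open GradedBubbles (Fam fdiffF iterD IsStep)

/-! ## §0 Norm bookkeeping on `ℤ⁴` -/

/-- [folklore] A coordinate is bounded by the sup norm. -/
theorem abs_coord_le_supNorm (v : Pt) (i : Fin 4) : |((v i : ℤ) : ℝ)| ≤ (supNorm v : ℝ) := by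
  have h := LeadingCoefficient.abs_apply_le_norm (toReal v) i
  rwa [toReal_apply, norm_toReal] at h

/-- [folklore] A unit step has sup norm `1`. -/
theorem supNorm_of_isStep {a : Pt} (ha : IsStep a) : (supNorm a : ℝ) = 1 := by
  exact_mod_cast ha.supNorm_eq

/-- [folklore] Translating by `c` changes the sup norm by at most `‖c‖∞` (lower form). -/
theorem supNorm_le_supNorm_add_add (v c : Pt) : (supNorm v : ℝ) ≤ supNorm (v + c) + supNorm c := by
  have h := supNorm_sub_le_supNorm_add v c
  linarith

/-- [folklore] **EXPONENTIAL TRANSPORT**: `e^{−(δ/n)‖v+c‖∞} ≤ e^{δ‖c‖∞}·e^{−(δ/n)‖v‖∞}` (`n ≥ 1`, `δ ≥ 0`). -/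
theorem exp_transport {n : ℕ} (hn : 1 ≤ n) {δ : ℝ} (hδ : 0 ≤ δ) (v c : Pt) :
    Real.exp (-(δ / n) * supNorm (v + c)) ≤ Real.exp (δ * supNorm c) * Real.exp (-(δ / n) * supNorm v) := by
  rw [← Real.exp_add]
  apply Real.exp_le_exp.mpr
  have hn' : (1 : ℝ) ≤ n := by exact_mod_cast hn
  have hnpos : (0 : ℝ) < n := by linarith
  have h1 := supNorm_le_supNorm_add_add v c
  have hc0 : (0 : ℝ) ≤ supNorm c := Nat.cast_nonneg _
  have hδn : δ / n ≤ δ := div_le_self hδ hn'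
  have hδn0 : 0 ≤ δ / n := div_nonneg hδ hnpos.le
  nlinarith

/-- [folklore] **DENOMINATOR TRANSPORT**: `1/(‖v+c‖∞+1)^p ≤ (‖c‖∞+1)^p/(‖v‖∞+1)^p`. -/
theorem inv_pow_transport (v c : Pt) (p : ℕ) :
    1 / ((supNorm (v + c) : ℝ) + 1) ^ p ≤ ((supNorm c : ℝ) + 1) ^ p / ((supNorm v : ℝ) + 1) ^ p := by
  have h1 := supNorm_le_supNorm_add_add v c
  have hc0 : (0 : ℝ) ≤ supNorm c := Nat.cast_nonneg _
  have hvc0 : (0 : ℝ) ≤ supNorm (v + c) := Nat.cast_nonneg _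
  have hv0 : (0 : ℝ) ≤ supNorm v := Nat.cast_nonneg _
  rw [div_le_div_iff₀ (by positivity) (by positivity), one_mul, ← mul_pow]
  apply pow_le_pow_left₀ (by positivity)
  nlinarith

/-- [folklore] **SOFT TRANSPORT**: a soft-exponential bound `|ψ u| ≤ B·e^{−(δ/n)‖u‖∞}/(‖u‖∞+1)^p` (all `u`) survives a translation by `c`
with the constant multiplied by `e^{δ‖c‖∞}(‖c‖∞+1)^p`. -/
theorem abs_shift_le_soft {n : ℕ} (hn : 1 ≤ n) {δ B : ℝ} (hδ : 0 ≤ δ) (hB : 0 ≤ B) {p : ℕ} {ψ : Pt → ℝ}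
    (h : ∀ u : Pt, |ψ u| ≤ B * Real.exp (-(δ / n) * supNorm u) / ((supNorm u : ℝ) + 1) ^ p) (v c : Pt) :
    |ψ (v + c)| ≤ B * (Real.exp (δ * supNorm c) * ((supNorm c : ℝ) + 1) ^ p) * Real.exp (-(δ / n) * supNorm v) / ((supNorm v : ℝ) + 1) ^ p := by
  refine (h (v + c)).trans ?_
  have he := exp_transport hn hδ v c
  have hd := inv_pow_transport v c p
  have hv0 : (0 : ℝ) < (supNorm v : ℝ) + 1 := by positivity
  have hvc0 : (0 : ℝ) < (supNorm (v + c) : ℝ) + 1 := by positivity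
  calc B * Real.exp (-(δ / n) * supNorm (v + c)) / ((supNorm (v + c) : ℝ) + 1) ^ p
      = B * Real.exp (-(δ / n) * supNorm (v + c)) * (1 / ((supNorm (v + c) : ℝ) + 1) ^ p) := by ring
    _ ≤ B * (Real.exp (δ * supNorm c) * Real.exp (-(δ / n) * supNorm v)) * (((supNorm c : ℝ) + 1) ^ p / ((supNorm v : ℝ) + 1) ^ p) := by
        gcongr
    _ = _ := by ring

/-! ## §1 Soft forms of the rows d0∕d1 (valid at every `v`, `(‖v‖∞+1)`-denominators) -/

section Rows

variable {n : ℕ} {δ A₀ A₁ D₀ : ℝ} {g : Pt → ℝ}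

/-- [folklore] The constant of the flat row is nonnegative. -/
theorem flat_nonneg (h0 : ∀ v : Pt, |g v - gFree v| ≤ D₀ / (n : ℝ) ^ 2) : 0 ≤ D₀ / (n : ℝ) ^ 2 := (abs_nonneg _).trans (h0 0)

/-- [folklore] The value at the origin from the flat row: `|g 0| ≤ |gFree 0| + D₀` (`n ≥ 1`). -/
theorem abs_apply_zero_le (hn : 1 ≤ n) (h0 : ∀ v : Pt, |g v - gFree v| ≤ D₀ / (n : ℝ) ^ 2) : |g 0| ≤ |gFree 0| + D₀ := by
  have hD := flat_nonneg h0
  have hn' : (1 : ℝ) ≤ (n : ℝ) ^ 2 := one_le_pow₀ (by exact_mod_cast hn)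
  have hD₀ : 0 ≤ D₀ := by
    have := mul_nonneg hD (le_trans zero_le_one hn')
    rwa [div_mul_cancel₀ _ (by positivity)] at this
  have h1 : |g 0 - gFree 0| ≤ D₀ := (h0 0).trans (div_le_self hD₀ hn')
  have := abs_sub_abs_le_abs_sub (g 0) (gFree 0)
  linarith

/-- [folklore] **SOFT ROW d0**: from d0 (off the origin) and h0 (at the origin), for ALL `v`,
`|g v| ≤ (4A₀ + |gFree 0| + D₀)·e^{−(δ/n)‖v‖∞}/(‖v‖∞+1)²`. -/
theorem soft_d0 (hn : 1 ≤ n) (hA₀ : 0 ≤ A₀)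
    (d0 : ∀ v : Pt, v ≠ 0 → |g v| ≤ A₀ * Real.exp (-(δ / n) * supNorm v) / (supNorm v : ℝ) ^ 2)
    (h0 : ∀ v : Pt, |g v - gFree v| ≤ D₀ / (n : ℝ) ^ 2) (v : Pt) :
    |g v| ≤ (4 * A₀ + (|gFree 0| + D₀)) * Real.exp (-(δ / n) * supNorm v) / ((supNorm v : ℝ) + 1) ^ 2 := by
  have hz := abs_apply_zero_le hn h0
  have hgD : 0 ≤ |gFree 0| + D₀ := (abs_nonneg _).trans hz
  by_cases hv : v = 0
  · subst hv
    have hs : (supNorm (0 : Pt) : ℝ) = 0 := by exact_mod_cast supNorm_eq_zero_iff.mpr rfl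
    rw [hs, mul_zero, Real.exp_zero, zero_add, one_pow, mul_one, div_one]
    linarith
  · have hs1 : (1 : ℝ) ≤ supNorm v := BubbleTransfer.Leg.one_le_supNorm hv
    set s : ℝ := (supNorm v : ℝ) with hs
    set E : ℝ := Real.exp (-(δ / n) * s) with hE
    have hE0 : 0 < E := Real.exp_pos _
    refine (d0 v hv).trans ?_
    rw [div_le_div_iff₀ (by positivity) (by positivity)]
    have h4 : (s + 1) ^ 2 ≤ 4 * s ^ 2 := by
      have h2 : s + 1 ≤ 2 * s := by linarith
      calc (s + 1) ^ 2 ≤ (2 * s) ^ 2 := pow_le_pow_left₀ (by positivity) h2 2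
        _ = 4 * s ^ 2 := by ring
    calc A₀ * E * (s + 1) ^ 2 ≤ A₀ * E * (4 * s ^ 2) := by gcongr
      _ = 4 * A₀ * E * s ^ 2 := by ring
      _ ≤ (4 * A₀ + (|gFree 0| + D₀)) * E * s ^ 2 := by gcongr; linarith

/-- [folklore] **SOFT ROW d1**: from d1 (off the origin), d0 and h0 (at the origin), for ALL `v` and every axis `ρ`,
`|g (v + e_ρ) − g v| ≤ (8A₁ + A₀ + |gFree 0| + D₀)·e^{−(δ/n)‖v‖∞}/(‖v‖∞+1)³`. -/
theorem soft_d1 (hn : 1 ≤ n) (hδ : 0 ≤ δ) (hA₀ : 0 ≤ A₀) (hA₁ : 0 ≤ A₁)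
    (d0 : ∀ v : Pt, v ≠ 0 → |g v| ≤ A₀ * Real.exp (-(δ / n) * supNorm v) / (supNorm v : ℝ) ^ 2)
    (d1 : ∀ v : Pt, v ≠ 0 → ∀ ρ : Fin 4, |g (v + unitVec ρ) - g v| ≤ A₁ * Real.exp (-(δ / n) * supNorm v) / (supNorm v : ℝ) ^ 3)
    (h0 : ∀ v : Pt, |g v - gFree v| ≤ D₀ / (n : ℝ) ^ 2) (v : Pt) (ρ : Fin 4) :
    |g (v + unitVec ρ) - g v| ≤ (8 * A₁ + (A₀ + (|gFree 0| + D₀))) * Real.exp (-(δ / n) * supNorm v) / ((supNorm v : ℝ) + 1) ^ 3 := by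
  have hz := abs_apply_zero_le hn h0
  have hgD : 0 ≤ |gFree 0| + D₀ := (abs_nonneg _).trans hz
  have hnpos : (0 : ℝ) < n := by exact_mod_cast (show 0 < n by omega)
  by_cases hv : v = 0
  · subst hv
    have hs : (supNorm (0 : Pt) : ℝ) = 0 := by exact_mod_cast supNorm_eq_zero_iff.mpr rfl
    rw [hs, mul_zero, Real.exp_zero]
    simp only [zero_add, one_pow, mul_one, div_one]
    have hne : (unitVec ρ : Pt) ≠ 0 := by
      intro h
      have h1 := supNorm_unitVec ρ
      rw [h, supNorm_eq_zero_iff.mpr rfl] at h1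
      exact absurd h1 (by norm_num)
    have he : |g (unitVec ρ)| ≤ A₀ := by
      refine (d0 _ hne).trans ?_
      rw [supNorm_unitVec, Nat.cast_one, one_pow, div_one]
      have : Real.exp (-(δ / n) * (1 : ℝ)) ≤ 1 := Real.exp_le_one_iff.mpr (by have := div_nonneg hδ hnpos.le; linarith)
      exact (mul_le_mul_of_nonneg_left this hA₀).trans (by rw [mul_one])
    calc |g (unitVec ρ) - g 0| ≤ |g (unitVec ρ)| + |g 0| := abs_sub _ _
      _ ≤ A₀ + (|gFree 0| + D₀) := add_le_add he hz
      _ ≤ 8 * A₁ + (A₀ + (|gFree 0| + D₀)) := by linarith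
  · have hs1 : (1 : ℝ) ≤ supNorm v := BubbleTransfer.Leg.one_le_supNorm hv
    set s : ℝ := (supNorm v : ℝ) with hs
    set E : ℝ := Real.exp (-(δ / n) * s) with hE
    have hE0 : 0 < E := Real.exp_pos _
    refine (d1 v hv ρ).trans ?_
    rw [div_le_div_iff₀ (by positivity) (by positivity)]
    have h8 : (s + 1) ^ 3 ≤ 8 * s ^ 3 := by
      have h2 : s + 1 ≤ 2 * s := by linarith
      calc (s + 1) ^ 3 ≤ (2 * s) ^ 3 := pow_le_pow_left₀ (by positivity) h2 3
        _ = 8 * s ^ 3 := by ring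
    calc A₁ * E * (s + 1) ^ 3 ≤ A₁ * E * (8 * s ^ 3) := by gcongr
      _ = 8 * A₁ * E * s ^ 3 := by ring
      _ ≤ (8 * A₁ + (A₀ + (|gFree 0| + D₀))) * E * s ^ 3 := by gcongr; linarith

end Rows

/-! ## §2 Propagation of bounds through iterated unit differences of constant families -/

section Propagation

variable {n : ℕ} {δ B M : ℝ} {p : ℕ}

/-- [folklore] Unfolding: one more step in front is a difference of the base function (constant families). -/
theorem iterD_const_cons (a : Pt) (as : List Pt) (ψ : Pt → ℝ) :
    iterD (a :: as) (fun (_ : ℕ) (_ : ℕ) => ψ) = iterD as (fun (_ : ℕ) (_ : ℕ) => fun v => ψ (v + a) - ψ v) := rfl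

/-- [folklore] **SUP BOUNDS DOUBLE PER DIFFERENCE**: `|ψ| ≤ M ⇒ |∂^{as}ψ| ≤ 2^{|as|}·M`. -/
theorem abs_iterD_const_le_of_sup {ψ : Pt → ℝ} (h : ∀ v, |ψ v| ≤ M) (as : List Pt) (u : Pt) :
    |iterD as (fun (_ : ℕ) (_ : ℕ) => ψ) 0 0 u| ≤ 2 ^ as.length * M := by
  induction as generalizing ψ M with
  | nil => simpa [iterD] using h u
  | cons a as ih =>
      rw [iterD_const_cons, List.length_cons, pow_succ]
      have h' : ∀ v, |ψ (v + a) - ψ v| ≤ 2 * M := fun v =>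
        (abs_sub _ _).trans (by have := h (v + a); have := h v; linarith)
      have := ih h'
      calc |iterD as (fun (_ : ℕ) (_ : ℕ) => fun v => ψ (v + a) - ψ v) 0 0 u| ≤ 2 ^ as.length * (2 * M) := this
        _ = 2 ^ as.length * 2 * M := by ring

/-- [folklore] **ONE UNIT DIFFERENCE OF A SOFT-EXPONENTIAL BOUND** keeps the shape: constant `× (1 + 2^p e^δ)` (`n ≥ 1`, `δ ≥ 0`). -/
theorem abs_fdiff_const_le_soft (hn : 1 ≤ n) (hδ : 0 ≤ δ) (hB : 0 ≤ B) {ψ : Pt → ℝ}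
    (h : ∀ u : Pt, |ψ u| ≤ B * Real.exp (-(δ / n) * supNorm u) / ((supNorm u : ℝ) + 1) ^ p) {a : Pt} (ha : IsStep a) (v : Pt) :
    |ψ (v + a) - ψ v| ≤ B * (1 + 2 ^ p * Real.exp δ) * Real.exp (-(δ / n) * supNorm v) / ((supNorm v : ℝ) + 1) ^ p := by
  have h1 := abs_shift_le_soft hn hδ hB h v a
  rw [supNorm_of_isStep ha, mul_one, show ((1 : ℝ) + 1) = 2 by norm_num] at h1
  have h2 := h v
  set E : ℝ := Real.exp (-(δ / n) * supNorm v)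
  set D : ℝ := ((supNorm v : ℝ) + 1) ^ p
  have hD : 0 < D := by positivity
  calc |ψ (v + a) - ψ v| ≤ |ψ (v + a)| + |ψ v| := abs_sub _ _
    _ ≤ B * (Real.exp δ * 2 ^ p) * E / D + B * E / D := add_le_add h1 h2
    _ = B * (1 + 2 ^ p * Real.exp δ) * E / D := by
        field_simp
        ring

/-- [folklore] **ITERATED UNIT DIFFERENCES OF A SOFT-EXPONENTIAL BOUND**: constant `× (1 + 2^p e^δ)^{|as|}`. -/
theorem abs_iterD_const_le_soft (hn : 1 ≤ n) (hδ : 0 ≤ δ) (hB : 0 ≤ B) {ψ : Pt → ℝ}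
    (h : ∀ u : Pt, |ψ u| ≤ B * Real.exp (-(δ / n) * supNorm u) / ((supNorm u : ℝ) + 1) ^ p) {as : List Pt} (has : ∀ a ∈ as, IsStep a)
    (u : Pt) :
    |iterD as (fun (_ : ℕ) (_ : ℕ) => ψ) 0 0 u| ≤ B * (1 + 2 ^ p * Real.exp δ) ^ as.length * Real.exp (-(δ / n) * supNorm u) / ((supNorm u : ℝ) + 1) ^ p := by
  induction as generalizing ψ B with
  | nil => simpa [iterD] using h u
  | cons a as ih =>
      rw [iterD_const_cons, List.length_cons, pow_succ]
      have ha : IsStep a := has a (by simp)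
      have h' := abs_fdiff_const_le_soft hn hδ hB h ha
      have hB' : 0 ≤ B * (1 + 2 ^ p * Real.exp δ) := by positivity
      have := ih hB' h' (fun b hb => has b (List.mem_cons_of_mem a hb))
      calc |iterD as (fun (_ : ℕ) (_ : ℕ) => fun v => ψ (v + a) - ψ v) 0 0 u|
          ≤ B * (1 + 2 ^ p * Real.exp δ) * (1 + 2 ^ p * Real.exp δ) ^ as.length * Real.exp (-(δ / n) * supNorm u) / ((supNorm u : ℝ) + 1) ^ p := this
        _ = B * ((1 + 2 ^ p * Real.exp δ) ^ as.length * (1 + 2 ^ p * Real.exp δ)) * Real.exp (-(δ / n) * supNorm u) / ((supNorm u : ℝ) + 1) ^ p := by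
            ring

end Propagation

/-! ## §3 The legs: flat part, far form, fixed-`n` envelope -/

section Legs

variable {n : ℕ} {δ A₀ A₁ D₀ D₁ : ℝ} {g : Pt → ℝ}

/-- [folklore] A backward unit step read as a forward one: for `a = −e_ρ`, `ψ (v + a) − ψ v = −(ψ (v' + e_ρ) − ψ v')` with `v' = v + a`. -/
theorem diff_neg_unitVec (ψ : Pt → ℝ) (v : Pt) (ρ : Fin 4) :
    ψ (v + -unitVec ρ) - ψ v = -(ψ (v + -unitVec ρ + unitVec ρ) - ψ (v + -unitVec ρ)) := by
  rw [neg_add_cancel_right]; ring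

/-- [folklore] **THE FLAT PART, NO DIFFERENCE** (row h0 verbatim): `|∂^{[]}(g − gFree)(u)| ≤ D₀/n²`. -/
theorem abs_iterD_flat_nil_le (h0 : ∀ v : Pt, |g v - gFree v| ≤ D₀ / (n : ℝ) ^ 2) (u : Pt) :
    |iterD [] (fun (_ : ℕ) (_ : ℕ) => fun v => g v - gFree v) 0 0 u| ≤ D₀ / (n : ℝ) ^ 2 := by
  simpa [iterD] using h0 u

/-- [folklore] One unit difference of the flat part (row h1, both orientations): `≤ D₁/n³`. -/
theorem abs_fdiff_flat_le (h1 : ∀ (v : Pt) (ρ : Fin 4), |(g (v + unitVec ρ) - gFree (v + unitVec ρ)) - (g v - gFree v)| ≤ D₁ / (n : ℝ) ^ 3)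
    {a : Pt} (ha : IsStep a) (v : Pt) :
    |(g (v + a) - gFree (v + a)) - (g v - gFree v)| ≤ D₁ / (n : ℝ) ^ 3 := by
  obtain ⟨ρ, rfl | rfl⟩ := ha
  · exact h1 v ρ
  · rw [diff_neg_unitVec (fun v => g v - gFree v) v ρ, abs_neg]
    exact h1 _ ρ

/-- [folklore] **THE FLAT PART WITH `k ≥ 1` DIFFERENCES**: `|∂^{a :: as}(g − gFree)(u)| ≤ 2^{|as|}·D₁/n³` (first difference by h1, the rest crude). -/
theorem abs_iterD_flat_cons_le (h1 : ∀ (v : Pt) (ρ : Fin 4), |(g (v + unitVec ρ) - gFree (v + unitVec ρ)) - (g v - gFree v)| ≤ D₁ / (n : ℝ) ^ 3)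
    {a : Pt} {as : List Pt} (ha : IsStep a) (u : Pt) :
    |iterD (a :: as) (fun (_ : ℕ) (_ : ℕ) => fun v => g v - gFree v) 0 0 u| ≤ 2 ^ as.length * (D₁ / (n : ℝ) ^ 3) := by
  rw [iterD_const_cons]
  exact abs_iterD_const_le_of_sup (fun v => abs_fdiff_flat_le h1 ha v) as u

/-- [folklore] **THE FAR FORM, NO DIFFERENCE** (= `soft_d0`). -/
theorem abs_iterD_far_nil_le (hn : 1 ≤ n) (hA₀ : 0 ≤ A₀)
    (d0 : ∀ v : Pt, v ≠ 0 → |g v| ≤ A₀ * Real.exp (-(δ / n) * supNorm v) / (supNorm v : ℝ) ^ 2)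
    (h0 : ∀ v : Pt, |g v - gFree v| ≤ D₀ / (n : ℝ) ^ 2) (u : Pt) :
    |iterD [] (fun (_ : ℕ) (_ : ℕ) => g) 0 0 u| ≤ (4 * A₀ + (|gFree 0| + D₀)) * Real.exp (-(δ / n) * supNorm u) / ((supNorm u : ℝ) + 1) ^ 2 := by
  simpa [iterD] using soft_d0 hn hA₀ d0 h0 u

/-- [folklore] One unit difference of `g`, both orientations, soft form: `≤ 8e^δ·(8A₁ + A₀ + |gFree 0| + D₀)·E(v)/(‖v‖∞+1)³`. -/
theorem abs_fdiff_far_le (hn : 1 ≤ n) (hδ : 0 ≤ δ) (hA₀ : 0 ≤ A₀) (hA₁ : 0 ≤ A₁)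
    (d0 : ∀ v : Pt, v ≠ 0 → |g v| ≤ A₀ * Real.exp (-(δ / n) * supNorm v) / (supNorm v : ℝ) ^ 2)
    (d1 : ∀ v : Pt, v ≠ 0 → ∀ ρ : Fin 4, |g (v + unitVec ρ) - g v| ≤ A₁ * Real.exp (-(δ / n) * supNorm v) / (supNorm v : ℝ) ^ 3)
    (h0 : ∀ v : Pt, |g v - gFree v| ≤ D₀ / (n : ℝ) ^ 2) {a : Pt} (ha : IsStep a) (v : Pt) :
    |g (v + a) - g v| ≤ (8 * A₁ + (A₀ + (|gFree 0| + D₀))) * (8 * Real.exp δ) * Real.exp (-(δ / n) * supNorm v) / ((supNorm v : ℝ) + 1) ^ 3 := by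
  have hB : 0 ≤ 8 * A₁ + (A₀ + (|gFree 0| + D₀)) := by
    have := (abs_nonneg _).trans (abs_apply_zero_le hn h0)
    positivity
  have hsoft := soft_d1 hn hδ hA₀ hA₁ d0 d1 h0
  obtain ⟨ρ, rfl | rfl⟩ := ha
  · refine (hsoft v ρ).trans ?_
    rw [div_le_div_iff_of_pos_right (by positivity)]
    refine mul_le_mul_of_nonneg_right ?_ (Real.exp_pos _).le
    have : (1 : ℝ) ≤ 8 * Real.exp δ := by have := Real.one_le_exp hδ; linarith
    exact le_mul_of_one_le_right hB this
  · rw [diff_neg_unitVec g v ρ, abs_neg]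
    have hneg : IsStep (-unitVec ρ : Pt) := ⟨ρ, Or.inr rfl⟩
    have h := abs_shift_le_soft hn hδ hB (p := 3) (ψ := fun u => g (u + unitVec ρ) - g u) (fun u => hsoft u ρ) v (-unitVec ρ)
    rw [supNorm_of_isStep hneg, mul_one, show ((1 : ℝ) + 1) ^ 3 = 8 by norm_num] at h
    refine h.trans (le_of_eq ?_)
    ring

/-- [folklore] **THE FAR FORM WITH `k ≥ 1` DIFFERENCES**: `|∂^{a :: as}g (u)| ≤ (8A₁ + A₀ + |gFree 0| + D₀)·8e^δ·(1 + 8e^δ)^{|as|}·E(u)/(‖u‖∞+1)³`. -/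
theorem abs_iterD_far_cons_le (hn : 1 ≤ n) (hδ : 0 ≤ δ) (hA₀ : 0 ≤ A₀) (hA₁ : 0 ≤ A₁)
    (d0 : ∀ v : Pt, v ≠ 0 → |g v| ≤ A₀ * Real.exp (-(δ / n) * supNorm v) / (supNorm v : ℝ) ^ 2)
    (d1 : ∀ v : Pt, v ≠ 0 → ∀ ρ : Fin 4, |g (v + unitVec ρ) - g v| ≤ A₁ * Real.exp (-(δ / n) * supNorm v) / (supNorm v : ℝ) ^ 3)
    (h0 : ∀ v : Pt, |g v - gFree v| ≤ D₀ / (n : ℝ) ^ 2) {a : Pt} {as : List Pt} (ha : IsStep a) (has : ∀ b ∈ as, IsStep b) (u : Pt) :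
    |iterD (a :: as) (fun (_ : ℕ) (_ : ℕ) => g) 0 0 u| ≤
      (8 * A₁ + (A₀ + (|gFree 0| + D₀))) * (8 * Real.exp δ) * (1 + 2 ^ 3 * Real.exp δ) ^ as.length *
        Real.exp (-(δ / n) * supNorm u) / ((supNorm u : ℝ) + 1) ^ 3 := by
  rw [iterD_const_cons]
  have hB : 0 ≤ (8 * A₁ + (A₀ + (|gFree 0| + D₀))) * (8 * Real.exp δ) := by
    have := (abs_nonneg _).trans (abs_apply_zero_le hn h0)
    positivity
  exact abs_iterD_const_le_soft hn hδ hB (fun v => abs_fdiff_far_le hn hδ hA₀ hA₁ d0 d1 h0 ha v) has u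

/-- [folklore] A soft-exponential bound in the sup norm is an `ℓ¹`-exponential bound at a quarter of the rate (`|v|₁ ≤ 4‖v‖∞`). -/
theorem exp_supNorm_le_exp_l1 {c : ℝ} (hc : 0 ≤ c) (v : Pt) : Real.exp (-c * supNorm v) ≤ Real.exp (-(c / 4) * l1 v) := by
  apply Real.exp_le_exp.mpr
  -- `|v|₁ ≤ 4‖v‖∞` (the tree's `GluonLegTails.l1_le_four_mul_supNorm`, re-derived inline to keep this module's imports light)
  have h4 : l1 v ≤ 4 * (supNorm v : ℝ) := by
    unfold l1
    calc ∑ μ : Fin 4, |((v μ : ℤ) : ℝ)| ≤ ∑ _μ : Fin 4, (supNorm v : ℝ) := Finset.sum_le_sum fun μ _ => abs_coord_le_supNorm v μ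
      _ = 4 * (supNorm v : ℝ) := by simp [Finset.sum_const, Finset.card_univ, Fintype.card_fin]
  nlinarith

/-- [folklore] **THE FIXED-`n` `ℓ¹` ENVELOPE OF EVERY LEG** (for summability only; the constant depends on everything): under d0∕d1∕h0,
for every list of unit steps `∃ C, ∀ u, |∂^{as}g (u)| ≤ C·e^{−(δ/(4n))|u|₁}`. -/
theorem exists_envelope_iterD (hn : 1 ≤ n) (hδ : 0 ≤ δ) (hA₀ : 0 ≤ A₀) (hA₁ : 0 ≤ A₁)
    (d0 : ∀ v : Pt, v ≠ 0 → |g v| ≤ A₀ * Real.exp (-(δ / n) * supNorm v) / (supNorm v : ℝ) ^ 2)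
    (d1 : ∀ v : Pt, v ≠ 0 → ∀ ρ : Fin 4, |g (v + unitVec ρ) - g v| ≤ A₁ * Real.exp (-(δ / n) * supNorm v) / (supNorm v : ℝ) ^ 3)
    (h0 : ∀ v : Pt, |g v - gFree v| ≤ D₀ / (n : ℝ) ^ 2) {as : List Pt} (has : ∀ b ∈ as, IsStep b) :
    ∃ C : ℝ, 0 ≤ C ∧ ∀ u : Pt, |iterD as (fun (_ : ℕ) (_ : ℕ) => g) 0 0 u| ≤ C * Real.exp (-(δ / n / 4) * l1 u) := by
  have hz := (abs_nonneg _).trans (abs_apply_zero_le hn h0)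
  have hnpos : (0 : ℝ) < n := by exact_mod_cast (show 0 < n by omega)
  have hc : 0 ≤ δ / n := div_nonneg hδ hnpos.le
  -- a soft bound (either arity) implies the envelope after dropping the denominator
  have key : ∀ (B : ℝ) (p : ℕ), 0 ≤ B → (∀ u : Pt, |iterD as (fun (_ : ℕ) (_ : ℕ) => g) 0 0 u| ≤
      B * Real.exp (-(δ / n) * supNorm u) / ((supNorm u : ℝ) + 1) ^ p) →
      ∃ C : ℝ, 0 ≤ C ∧ ∀ u : Pt, |iterD as (fun (_ : ℕ) (_ : ℕ) => g) 0 0 u| ≤ C * Real.exp (-(δ / n / 4) * l1 u) := by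
    intro B p hB h
    refine ⟨B, hB, fun u => (h u).trans ?_⟩
    have hden : (1 : ℝ) ≤ ((supNorm u : ℝ) + 1) ^ p := one_le_pow₀ (by have : (0:ℝ) ≤ supNorm u := Nat.cast_nonneg _; linarith)
    calc B * Real.exp (-(δ / n) * supNorm u) / ((supNorm u : ℝ) + 1) ^ p ≤ B * Real.exp (-(δ / n) * supNorm u) := div_le_self (by positivity) hden
      _ ≤ B * Real.exp (-(δ / n / 4) * l1 u) := mul_le_mul_of_nonneg_left (exp_supNorm_le_exp_l1 hc u) hB
  cases as with
  | nil => exact key _ 2 (by positivity) (abs_iterD_far_nil_le hn hA₀ d0 h0)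
  | cons a as =>
      exact key _ 3 (by positivity) (abs_iterD_far_cons_le hn hδ hA₀ hA₁ d0 d1 h0 (has a (by simp)) (fun b hb => has b (List.mem_cons_of_mem a hb)))

end Legs

end Summit.QuantumFields.BalabanUV.Beta.D1BFx.ScaleLegRows

end
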